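import Mathlib.Analysis.Complex.Asymptotics
import Literature.NumberTheory.LFunctions.GaussianHeckeLSeries
import HarnessLib

/-!
# Non-vanishing of the Hecke `L`-functions `L(s, λ^m)` of `ℚ(i)` on the line `Re s = 1`

Topic `Literature/NumberTheory/LFunctions`.  Fifth brick of the proof of Hecke's theorem on
Gaussian primes in sectors (`Literature.NumberTheory.LFunctions.GaussianInt.hecke_gaussianPrimes_inSectors`).
For the continued Dirichlet series `D_m(s) = ∑_{z ≠ 0} λ^m(z) N(z)^{-s} = 4 L(s, λ^m)`
(`Literature.NumberTheory.LFunctions.GaussianHecke.heckeL`) we PROVE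

* `heckeL_ne_zero_of_re_eq_one`: **`D_m(s) ≠ 0` for `Re s = 1`** and `(m, s) ≠ (0, 1)`
  (Hecke 1920, §7: `ζ(s, λ)` has no zero on `σ = 1`, the analytic input of his theorem on primes
  in sectors; for `m = 0` this is Landau's theorem for `ζ_{ℚ(i)}`), and the closed half-plane
  versions `heckeL_ne_zero_of_one_le_re` (`m ≥ 1`), `heckeL_zero_ne_zero_of_one_le_re`.

## Proof (Hadamard–de la Vallée-Poussin–Mertens, following Mathlib's `DirichletCharacter.LFunction_ne_zero_of_re_eq_one`)

On `Re s > 1`, `D_k = 4 e^{Q_k}` with `Q_k(s) = ∑_{π, j} j⁻¹ λ^k(π)^j N(π)^{-js}`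
(`heckeL_eq_four_mul_exp`).  Since `λ^{2m} = (λ^m)²` and `3 + 4 cos θ + cos 2θ = 2(1 + cos θ)² ≥ 0`,
`Re (3 Q_0(σ) + 4 Q_m(σ + it) + Q_{2m}(σ + 2it)) ≥ 0` (`re_comb_nonneg`), whence
`‖D_0(σ)³ D_m(σ+it)⁴ D_{2m}(σ+2it)‖ ≥ 4⁸ ≥ 1` for `σ > 1` (`one_le_norm_heckeL_product`).  If
`D_m(1+it) = 0` then, `D_m` being holomorphic at `1 + it` (entire for `m ≥ 1`; for `m = 0` we have
`t ≠ 0`), the left side is `O((σ-1)^{-3}) · O((σ-1)^4) · O(1) → 0` as `σ → 1⁺` — contradiction.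

## References

* E. Hecke, *Eine neue Art von Zetafunktionen und ihre Beziehungen zur Verteilung der
  Primzahlen. II*, Math. Z. 6 (1920), 11–51, §7. [HeckeMathZ1920]
-/

noncomputable section

open Complex Filter Topology Asymptotics Finset LSeries

namespace Literature.NumberTheory.LFunctions

namespace GaussianHecke

open GaussianInt GaussianTheta

local notation "ℤ[i]" => _root_.GaussianInt

open scoped Classical

/-! ### Positivity: `Re (3 Q_0(σ) + 4 Q_m(σ+it) + Q_{2m}(σ+2it)) ≥ 0` -/

/-- `Re (3 + 4w + w²) = 2 (1 + Re w)² ≥ 0` for `|w| = 1` (i.e. `3 + 4 cos θ + cos 2θ ≥ 0`).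
[folklore] -/
theorem re_three_add_nonneg {w : ℂ} (hw : ‖w‖ = 1) : 0 ≤ (3 + 4 * w + w ^ 2).re := by
  have h1 : w.re * w.re + w.im * w.im = 1 := by
    have h := Complex.sq_norm w
    rw [hw, Complex.normSq_apply, one_pow] at h
    linarith
  have h2 : (3 + 4 * w + w ^ 2).re = 2 * (1 + w.re) ^ 2 := by
    simp only [add_re, mul_re, sq, re_ofNat, im_ofNat, zero_mul, sub_zero]
    nlinarith
  rw [h2]
  positivity

/-- `λ^{2m}(π) = λ^m(π)²`. [folklore] -/
theorem angularChar_two_mul (m : ℕ) (x : ℤ[i]) : angularChar (2 * m) x = angularChar m x ^ 2 := by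
  rw [angularChar_def, angularChar_def, ← pow_mul]
  congr 1
  ring

/-- The `n`-th term of `3 Q_0(σ) + 4 Q_m(σ+it) + Q_{2m}(σ+2it)` has nonnegative real part
(`σ` real). With `u = n^{-it}` and `w = λ^m(π)^j u` it is
`n^{-σ} ∑_{(π,j)} j⁻¹ (3 + 4w + w²)`. [folklore] -/
theorem re_term_comb_nonneg (m : ℕ) (σ t : ℝ) (n : ℕ) :
    0 ≤ (3 * term (qCoeff 0) σ n + 4 * term (qCoeff m) (σ + t * I) n +
      term (qCoeff (2 * m)) (σ + 2 * t * I) n).re := by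
  rcases eq_or_ne n 0 with rfl | hn
  · simp
  have hn0 : (n : ℂ) ≠ 0 := Nat.cast_ne_zero.mpr hn
  set u : ℂ := (n : ℂ) ^ (-(t * I)) with hu
  have hnu : ‖u‖ = 1 := by
    rw [hu, Complex.norm_natCast_cpow_of_pos (Nat.pos_of_ne_zero hn)]; simp
  set r : ℝ := (n : ℝ) ^ σ with hr
  have hr0 : 0 < r := Real.rpow_pos_of_pos (Nat.cast_pos.mpr (Nat.pos_of_ne_zero hn)) σ
  have hnσ : (n : ℂ) ^ (σ : ℂ) = (r : ℂ) := by
    rw [hr, Complex.ofReal_cpow (Nat.cast_nonneg n)]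
    norm_cast
  have hrc : (r : ℂ) ≠ 0 := ofReal_ne_zero.mpr hr0.ne'
  have hn1 : (n : ℂ) ^ ((t : ℂ) * I) ≠ 0 := fun h ↦ hn0 ((cpow_eq_zero_iff _ _).mp h).1
  have hn2 : (n : ℂ) ^ (2 * (t : ℂ) * I) ≠ 0 := fun h ↦ hn0 ((cpow_eq_zero_iff _ _).mp h).1
  have h1 : term (qCoeff 0) σ n = (r : ℂ)⁻¹ * qCoeff 0 n := by
    rw [term_of_ne_zero hn, hnσ, div_eq_inv_mul]
  have h2 : term (qCoeff m) (σ + t * I) n = (r : ℂ)⁻¹ * (qCoeff m n * u) := by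
    rw [term_of_ne_zero hn, cpow_add _ _ hn0, hnσ, hu, cpow_neg]
    field_simp
  have h3 : term (qCoeff (2 * m)) (σ + 2 * t * I) n = (r : ℂ)⁻¹ * (qCoeff (2 * m) n * u ^ 2) := by
    have hu2 : u ^ 2 = ((n : ℂ) ^ (2 * t * I))⁻¹ := by
      rw [hu, ← cpow_nat_mul, ← cpow_neg]
      congr 1
      push_cast
      ring
    rw [term_of_ne_zero hn, cpow_add _ _ hn0, hnσ, hu2]
    field_simp
  rw [h1, h2, h3, show (3 : ℂ) * ((r : ℂ)⁻¹ * qCoeff 0 n) + 4 * ((r : ℂ)⁻¹ * (qCoeff m n * u)) +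
      (r : ℂ)⁻¹ * (qCoeff (2 * m) n * u ^ 2) =
      (r : ℂ)⁻¹ * (3 * qCoeff 0 n + 4 * (qCoeff m n * u) + qCoeff (2 * m) n * u ^ 2) by ring,
    ← Complex.ofReal_inv, re_ofReal_mul]
  refine mul_nonneg (inv_nonneg.mpr hr0.le) ?_
  -- expand the three coefficient sums over `pairsNorm n`
  have hexp : 3 * qCoeff 0 n + 4 * (qCoeff m n * u) + qCoeff (2 * m) n * u ^ 2 =
      ∑ p ∈ pairsNorm n, (((p.2 : ℝ)⁻¹ : ℝ) : ℂ) *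
        (3 + 4 * (angularChar m p.1 ^ p.2 * u) + (angularChar m p.1 ^ p.2 * u) ^ 2) := by
    simp only [qCoeff, mul_sum, sum_mul, ← sum_add_distrib]
    refine sum_congr rfl fun p _ ↦ ?_
    rw [angularChar_zero_left, one_pow, angularChar_two_mul, ← pow_mul, mul_comm 2 p.2, pow_mul]
    push_cast
    ring
  rw [hexp, re_sum]
  refine sum_nonneg fun p hp ↦ ?_
  obtain ⟨hπ, hj, -⟩ := mem_pairsNorm.mp hp
  have hπ0 : p.1 ≠ 0 := (mem_primesQ1.mp hπ).1.ne_zero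
  have hj0 : (0 : ℝ) < p.2 := by exact_mod_cast (mem_Icc.mp hj).1
  rw [re_ofReal_mul]
  refine mul_nonneg (inv_nonneg.mpr hj0.le) (re_three_add_nonneg ?_)
  rw [norm_mul, norm_pow, norm_angularChar hπ0, one_pow, one_mul, hnu]

/-- **`Re (3 Q_0(σ) + 4 Q_m(σ+it) + Q_{2m}(σ+2it)) ≥ 0`** for `σ > 1`. [folklore] -/
theorem re_comb_nonneg (m : ℕ) {σ : ℝ} (hσ : 1 < σ) (t : ℝ) :
    0 ≤ (3 * heckeQ 0 σ + 4 * heckeQ m (σ + t * I) + heckeQ (2 * m) (σ + 2 * t * I)).re := by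
  have hs1 : 1 < (σ : ℂ).re := by rwa [ofReal_re]
  have hs2 : 1 < ((σ : ℂ) + t * I).re := by
    rwa [add_re, ofReal_re, mul_re, ofReal_re, ofReal_im, I_re, I_im, mul_zero, zero_mul,
      sub_zero, add_zero]
  have hs3 : 1 < ((σ : ℂ) + 2 * t * I).re := by
    rw [show (2 : ℂ) * t * I = ((2 * t : ℝ) : ℂ) * I by push_cast; ring]
    rwa [add_re, ofReal_re, mul_re, ofReal_re, ofReal_im, I_re, I_im, mul_zero, zero_mul,
      sub_zero, add_zero]
  have hsum : HasSum (fun n ↦ 3 * term (qCoeff 0) σ n + 4 * term (qCoeff m) (σ + t * I) n +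
      term (qCoeff (2 * m)) (σ + 2 * t * I) n)
      (3 * heckeQ 0 σ + 4 * heckeQ m (σ + t * I) + heckeQ (2 * m) (σ + 2 * t * I)) :=
    (((LSeriesSummable_qCoeff 0 hs1).hasSum.mul_left 3).add
      ((LSeriesSummable_qCoeff m hs2).hasSum.mul_left 4)).add (LSeriesSummable_qCoeff (2 * m) hs3).hasSum
  rw [← hsum.tsum_eq, Complex.re_tsum hsum.summable]
  exact tsum_nonneg fun n ↦ re_term_comb_nonneg m σ t n

/-- **`‖D_0(σ)³ D_m(σ+it)⁴ D_{2m}(σ+2it)‖ ≥ 1`** for `σ = 1 + x > 1` (indeed `≥ 4⁸`): the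
`3-4-1` inequality for the Hecke `L`-functions of `ℚ(i)`. [cite: HeckeMathZ1920, §7] -/
theorem one_le_norm_heckeL_product (m : ℕ) {x : ℝ} (hx : 0 < x) (t : ℝ) :
    1 ≤ ‖heckeL 0 (1 + x) ^ 3 * heckeL m (1 + x + I * t) ^ 4 *
      heckeL (2 * m) (1 + x + 2 * I * t)‖ := by
  have hσ : 1 < 1 + x := by linarith
  have e1 : (1 : ℂ) + x = ((1 + x : ℝ) : ℂ) := by push_cast; ring
  have e2 : (1 : ℂ) + x + I * t = ((1 + x : ℝ) : ℂ) + t * I := by push_cast; ring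
  have e3 : (1 : ℂ) + x + 2 * I * t = ((1 + x : ℝ) : ℂ) + 2 * t * I := by push_cast; ring
  have hs1 : 1 < (((1 + x : ℝ) : ℂ)).re := by rwa [ofReal_re]
  have hs2 : 1 < (((1 + x : ℝ) : ℂ) + t * I).re := by
    rwa [add_re, ofReal_re, mul_re, ofReal_re, ofReal_im, I_re, I_im, mul_zero, zero_mul,
      sub_zero, add_zero]
  have hs3 : 1 < (((1 + x : ℝ) : ℂ) + 2 * t * I).re := by
    rw [show (2 : ℂ) * t * I = ((2 * t : ℝ) : ℂ) * I by push_cast; ring]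
    rwa [add_re, ofReal_re, mul_re, ofReal_re, ofReal_im, I_re, I_im, mul_zero, zero_mul,
      sub_zero, add_zero]
  rw [e2, e3, e1, norm_mul, norm_mul, norm_pow, norm_pow, norm_heckeL_eq 0 hs1,
    norm_heckeL_eq m hs2, norm_heckeL_eq (2 * m) hs3]
  set a := (heckeQ 0 ((1 + x : ℝ) : ℂ)).re
  set b := (heckeQ m (((1 + x : ℝ) : ℂ) + t * I)).re
  set c := (heckeQ (2 * m) (((1 + x : ℝ) : ℂ) + 2 * t * I)).re
  have hre : 0 ≤ 3 * a + 4 * b + c := by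
    have h := re_comb_nonneg m hσ t
    simp only [add_re, mul_re, re_ofNat, im_ofNat, zero_mul, sub_zero] at h
    exact h
  have hexp : Real.exp a ^ 3 * Real.exp b ^ 4 * Real.exp c = Real.exp (3 * a + 4 * b + c) := by
    rw [Real.exp_add, Real.exp_add, show (3 : ℝ) * a = (3 : ℕ) * a by norm_num, Real.exp_nat_mul,
      show (4 : ℝ) * b = (4 : ℕ) * b by norm_num, Real.exp_nat_mul]
  calc (1 : ℝ) ≤ 4 ^ 8 * Real.exp (3 * a + 4 * b + c) := by
        have := Real.one_le_exp hre
        nlinarith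
    _ = (4 * Real.exp a) ^ 3 * (4 * Real.exp b) ^ 4 * (4 * Real.exp c) := by rw [← hexp]; ring

/-! ### Behaviour near `σ = 1` and the contradiction -/

/-- `D_0(1 + x) = O(1/x)` as `x → 0⁺` (simple pole: `w D_0(1+w) = H(1+w) → H(1) = π`). [folklore] -/
theorem heckeL_zero_isBigO_near_one :
    (fun x : ℝ ↦ heckeL 0 (1 + x)) =O[𝓝[>] 0] fun x ↦ (1 : ℂ) / x := by
  have key : (fun w : ℂ ↦ heckeL 0 (1 + w)) =O[𝓝[≠] 0] (1 / ·) := by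
    have H : Tendsto (fun w ↦ w * heckeL 0 (1 + w)) (𝓝[≠] 0) (𝓝 (heckeH 1)) := by
      have hcont : ContinuousAt heckeH 1 := (differentiableAt_heckeH one_ne_zero).continuousAt
      have hsh : Tendsto (fun w : ℂ ↦ 1 + w) (𝓝 0) (𝓝 1) := by
        have : Continuous fun w : ℂ ↦ 1 + w := continuous_const.add continuous_id
        simpa using this.tendsto 0
      have h2 : Tendsto (fun w : ℂ ↦ heckeH (1 + w)) (𝓝[≠] 0) (𝓝 (heckeH 1)) :=
        (hcont.tendsto.comp hsh).mono_left nhdsWithin_le_nhds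
      refine h2.congr' ?_
      filter_upwards [self_mem_nhdsWithin] with w hw
      have hw1 : (1 : ℂ) + w ≠ 1 := by simpa using hw
      rw [heckeH_eq hw1]
      ring
    exact (isBigO_mul_iff_isBigO_div eventually_mem_nhdsWithin).mp <| H.isBigO_one ℂ
  exact (isBigO_comp_ofReal_nhds_ne key).mono <| nhdsGT_le_nhdsNE 0

/-- `D_m` is holomorphic at `1 + iy` unless `(m, y) = (0, 0)`. [folklore] -/
theorem differentiableAt_heckeL_one_add {m : ℕ} {y : ℝ} (h : m ≠ 0 ∨ y ≠ 0) :
    DifferentiableAt ℂ (heckeL m) (1 + I * y) := by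
  rcases Nat.eq_zero_or_pos m with rfl | hm
  · have hy : y ≠ 0 := h.resolve_left (fun h ↦ h rfl)
    refine differentiableAt_heckeL_zero (fun h0 ↦ ?_) (fun h1 ↦ ?_)
    · have := congrArg Complex.re h0
      simp at this
    · have := congrArg Complex.im h1
      simp [hy] at this
  · exact (differentiable_heckeL hm.ne').differentiableAt

/-- `D_{m}(1 + x + iy) = O(1)` as `x → 0⁺` (continuity), unless `(m, y) = (0, 0)`. [folklore] -/
theorem heckeL_isBigO_horizontal {m : ℕ} {y : ℝ} (h : m ≠ 0 ∨ y ≠ 0) :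
    (fun x : ℝ ↦ heckeL m (1 + x + I * y)) =O[𝓝[>] 0] fun _ ↦ (1 : ℂ) := by
  refine IsBigO.mono ?_ nhdsWithin_le_nhds
  simp_rw [add_comm (1 : ℂ), add_assoc]
  have hc := (differentiableAt_heckeL_one_add h).continuousAt
  rw [← zero_add (1 + _)] at hc
  exact hc.comp (f := fun x : ℝ ↦ x + (1 + I * y)) (x := 0) (by fun_prop) |>.tendsto.isBigO_one ℂ

/-- If `D_m(1 + iy) = 0` then `D_m(1 + x + iy) = O(x)` as `x → 0⁺`. [folklore] -/
theorem heckeL_isBigO_horizontal_of_eq_zero {m : ℕ} {y : ℝ} (h : m ≠ 0 ∨ y ≠ 0)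
    (h0 : heckeL m (1 + I * y) = 0) :
    (fun x : ℝ ↦ heckeL m (1 + x + I * y)) =O[𝓝[>] 0] fun x : ℝ ↦ (x : ℂ) := by
  simp_rw [add_comm (1 : ℂ), add_assoc]
  have hd := (differentiableAt_heckeL_one_add h).hasDerivAt
  rw [← zero_add (1 + _)] at hd
  simpa only [zero_add, h0, sub_zero]
    using (Complex.isBigO_comp_ofReal_nhds
      (hd.comp_add_const 0 _).differentiableAt.isBigO_sub) |>.mono nhdsWithin_le_nhds

/-- **`D_m(1 + it) ≠ 0` unless `(m, t) = (0, 0)`** (Hecke 1920, §7; `m = 0`: Landau 1903 for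
`ζ_{ℚ(i)}`). [cite: HeckeMathZ1920, §7] -/
theorem heckeL_one_add_ne_zero {m : ℕ} {t : ℝ} (h : m ≠ 0 ∨ t ≠ 0) :
    heckeL m (1 + I * t) ≠ 0 := by
  intro Hz
  have h2 : 2 * m ≠ 0 ∨ 2 * t ≠ 0 :=
    h.imp (fun hm ↦ by omega) (fun ht ↦ mul_ne_zero two_ne_zero ht)
  have help (x : ℝ) : ((1 / x) ^ 3 * x ^ 4 * 1 : ℂ) = x := by
    rcases eq_or_ne x 0 with rfl | hx
    · rw [ofReal_zero, zero_pow (by omega), mul_zero, mul_one]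
    · rw [one_div, inv_pow, pow_succ _ 3, ← mul_assoc,
        inv_mul_cancel₀ <| pow_ne_zero 3 (ofReal_ne_zero.mpr hx), one_mul, mul_one]
  have H₀ : (fun _ : ℝ ↦ (1 : ℝ)) =O[𝓝[>] 0]
      fun x ↦ heckeL 0 (1 + x) ^ 3 * heckeL m (1 + x + I * t) ^ 4 *
        heckeL (2 * m) (1 + x + 2 * I * t) :=
    IsBigO.of_bound' <| eventually_nhdsWithin_of_forall
      fun x hx ↦ (norm_one (α := ℝ)).symm ▸ one_le_norm_heckeL_product m hx t
  have H := (heckeL_zero_isBigO_near_one).pow 3 |>.mul <|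
    (heckeL_isBigO_horizontal_of_eq_zero h Hz).pow 4 |>.mul <|
    heckeL_isBigO_horizontal (m := 2 * m) (y := 2 * t) h2
  simp only [ofReal_mul, ofReal_ofNat, mul_left_comm I, ← mul_assoc, help] at H
  replace H := (H₀.trans H).norm_right
  simp only [norm_real] at H
  exact isLittleO_irrefl (.of_forall (fun _ ↦ one_ne_zero)) <|
    H.of_norm_right.trans_isLittleO <| isLittleO_id_one.mono nhdsWithin_le_nhds

/-- **`D_m(s) ≠ 0` for `Re s = 1`**, unless `m = 0` and `s = 1`. [cite: HeckeMathZ1920, §7] -/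
theorem heckeL_ne_zero_of_re_eq_one {m : ℕ} {s : ℂ} (hs : s.re = 1) (h : m ≠ 0 ∨ s ≠ 1) :
    heckeL m s ≠ 0 := by
  have hs' : s = 1 + I * s.im := by
    apply Complex.ext <;> simp [hs]
  rw [hs']
  refine heckeL_one_add_ne_zero (h.imp_right fun h1 him ↦ h1 ?_)
  rw [hs', him, ofReal_zero, mul_zero, add_zero]

/-- **`D_m(s) ≠ 0` for `Re s ≥ 1` when `m ≥ 1`.** [cite: HeckeMathZ1920, §7] -/
theorem heckeL_ne_zero_of_one_le_re {m : ℕ} (hm : m ≠ 0) {s : ℂ} (hs : 1 ≤ s.re) :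
    heckeL m s ≠ 0 := by
  rcases hs.eq_or_lt with h | h
  · exact heckeL_ne_zero_of_re_eq_one h.symm (Or.inl hm)
  · exact heckeL_ne_zero_of_one_lt_re m h

/-- **`D_0(s) ≠ 0` for `Re s ≥ 1`, `s ≠ 1`** (Landau: `ζ_{ℚ(i)}(s) ≠ 0` there). [cite: HeckeMathZ1920, §7] -/
theorem heckeL_zero_ne_zero_of_one_le_re {s : ℂ} (hs : 1 ≤ s.re) (hs1 : s ≠ 1) : heckeL 0 s ≠ 0 := by
  rcases hs.eq_or_lt with h | h
  · exact heckeL_ne_zero_of_re_eq_one h.symm (Or.inr hs1)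
  · exact heckeL_ne_zero_of_one_lt_re 0 h

end GaussianHecke

end Literature.NumberTheory.LFunctions
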